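import Summits.CriticalPhenomena.CardyFormulaZ2.Theorems.CardyIKTransportIKMixedBoxCrossingDefectStubGlueFirstColPos

/-!
# Stub `stub_bottomRowFloor` (line `defect-closure-exploration` v7, crux `IKMixedBoxCrossing`, stmt-CriticalPhenomena-5911)

Support file (`--supports stmt-CriticalPhenomena-5911`): the explicit, pattern-free CROSSING FLOOR of skeleton v7
used at the finitely many small scales of the two RSW assemblies (`stub_rswAssembly`, `stub_squaresFromTall`):

  `(1/2)^w ≤ P_S[black LR crossing of the w × h box at (a, b)]`   (`1 ≤ w`, `1 ≤ h`, every pattern `S`),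

registered signature `stub_bottomRowFloor`, exported as `bottomRowFloor`.  Theorems only (no new vocabulary).

Proof (the only place of the line where the explicit i.i.d. structure of ONE ROW of the gauge is used).
* THE ROW EVENT `{ω | ∀ i < w, (a+i, b) black}` is contained in the LR crossing event for `1 ≤ h`
  (`rowBlack_subset_lrCross`): the horizontal black run `(a, b) — (a+1, b) — … — (a+w-1, b)` is an open path of
  every triangulation (landed `GlueFirstColPosStub.openConnIn_hseg`), from the left column to the right column
  of the box, inside the box.
* ITS MASS IS EXACTLY `2^{-w}` (`real_rowBlack`): write `ω = (A, r)` (column signs `A = ω.1`, rest `r = ω.2`),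
  so that `μIK = Ber(½)^{⊗ℤ} ⊗ (law of the rest)` literally; the cell `(x, b)` is black iff `A x ⊕ t_x(r)` with
  `t_x(r)` (row sign of `b` ⊕ anchored plaquette parity) NOT reading `A` (`mem_blackSet_pair`, definitional), so
  every `r`-section of the row event is a cylinder of the column signs prescribing `w` distinct signs, of mass `2^{-w}`
  (`real_section_rowBlack`, by the landed `CondBoxStub.sitePercolation_real_cylinder`); Tonelli over the rest
  (`Measure.prod_apply_symm`) gives `2^{-w}`.
* `pLR ≥ μIK(row event) = (1/2)^w` by monotonicity (`measureReal_mono`).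
-/

noncomputable section

namespace Summit.CriticalPhenomena.CardyFormulaZ2.Cruxes.IKMixedBoxCrossing.QuenchedChainFKG

open scoped Classical
open MeasureTheory
open Literature.Probability.Percolation Literature.Probability.LatticeModels
open Summit.CriticalPhenomena.CardyFormulaZ2.Theorems.IKLinearTransport.PinnedDiagramExchange
  (Ω μIK Obs obs lrCross tbCross blackEdges blackSet antiSet parSet)
open Summit.CriticalPhenomena.CardyFormulaZ2.Theorems.IKLinearTransport.PinnedDiagramExchange.CouplingToLimits
  (isProbabilityMeasure_μIK measurable_mem_blackSet)
open Summit.CriticalPhenomena.CardyFormulaZ2.Cruxes.IKMixedBoxCrossing.PairedMirrorExploration (pLR pTB)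
open Summit.CriticalPhenomena.CardyFormulaZ2.Cruxes.IKMixedBoxCrossing.DefectClosureExploration.CondBoxStub
  (sitePercolation_real_cylinder)
open Summit.CriticalPhenomena.CardyFormulaZ2.Cruxes.IKMixedBoxCrossing.DefectClosureExploration.GlueFirstColPosStub
  (openConnIn_hseg)

namespace BottomRowFloor

/-! ## §1 The row event and the deterministic inclusion -/

/-- The row event {the `w` bottom cells `(a + i, b)`, `i < w`, are black} is measurable. [folklore] -/
theorem measurableSet_rowBlack (S : Set ℤ) (a b : ℤ) (w : ℕ) :
    MeasurableSet {ω : Ω | ∀ i : Fin w, (![a + ((i : ℕ) : ℤ), b] : Site 2) ∈ blackSet S ω} :=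
  measurableSet_setOf.2 (Measurable.forall fun _ => measurable_mem_blackSet S _)

/-- AN ALL-BLACK BOTTOM ROW CROSSES: for `1 ≤ w`, `1 ≤ h` the row event is contained in the black LR
crossing event of the `w × h` box at `(a, b)` (the horizontal black run is an open path of every triangulation,
from the left column `a` to the right column `a + w - 1`, inside the box). [folklore] -/
theorem rowBlack_subset_lrCross (S : Set ℤ) (a b : ℤ) {w h : ℕ} (hw : 1 ≤ w) (hh : 1 ≤ h) :
    {ω : Ω | ∀ i : Fin w, (![a + ((i : ℕ) : ℤ), b] : Site 2) ∈ blackSet S ω} ⊆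
      obs S ⁻¹' lrCross a b w h := by
  intro ω hω
  have hbl : ∀ z : ℤ, a ≤ z → z ≤ a + w - 1 → (![z, b] : Site 2) ∈ (obs S ω).1 := by
    intro z h1 h2
    obtain ⟨i, hi⟩ : ∃ i : Fin w, z = a + ((i : ℕ) : ℤ) :=
      ⟨⟨(z - a).toNat, by omega⟩, by simp only [Int.toNat_of_nonneg (by omega : (0 : ℤ) ≤ z - a)]; omega⟩
    rw [hi]
    exact hω i
  refine ⟨![a, b], ?_, ![a + w - 1, b], ?_,
    openConnIn_hseg (obs S ω) _ b a (a + w - 1) (by omega) (fun z h1 h2 => ?_) hbl⟩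
  · simp only [Set.mem_setOf_eq, Matrix.cons_val_zero, Matrix.cons_val_one, Matrix.cons_val_fin_one, true_and]
    omega
  · simp only [Set.mem_setOf_eq, Matrix.cons_val_zero, Matrix.cons_val_one, Matrix.cons_val_fin_one, true_and]
    omega
  · simp only [Set.mem_setOf_eq, Matrix.cons_val_zero, Matrix.cons_val_one, Matrix.cons_val_fin_one]
    omega

/-! ## §2 The mass of the row event: Tonelli over the rest of the gauge

The rest of the gauge is `ω.2 : Set ℤ × (Set (Site 2) × (Set (Site 2) × Set (Site 2)))` (row signs, biased
plaquettes, fair plaquettes, coins), and `μIK` is by definition `(sitePercolation ℤ half).prod (law of the rest)`. -/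

/-- COLOUR OF A CELL, column sign separated: `(x, y)` is black in `(A, r)` iff
`A x ⊕ (B y ⊕ parity of the plaquettes of the anchored rectangle of (x, y))`, the second summand NOT reading `A`
(the plaquette-parity set reads the rest only; definitional). [folklore] -/
theorem mem_blackSet_pair (S : Set ℤ) (A : Set ℤ) (r : Set ℤ × (Set (Site 2) × (Set (Site 2) × Set (Site 2))))
    (x y : ℤ) :
    (![x, y] : Site 2) ∈ blackSet S ((A, r) : Ω) ↔
      Xor (x ∈ A) (Xor (y ∈ r.1)
        (Odd ((Finset.filter (fun f : ℤ × ℤ => (![f.1, f.2] : Site 2) ∈ parSet S (((∅ : Set ℤ), r) : Ω))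
          (Finset.Ico (min 0 x) (max 0 x) ×ˢ Finset.Ico (min 0 y) (max 0 y))).card))) :=
  Iff.rfl

/-- `P ⊕ Q` solved for `P` against the Boolean `!decide Q`. [folklore] -/
theorem xor_iff_iff_bnot_decide (P Q : Prop) [Decidable Q] : Xor P Q ↔ (P ↔ (!decide Q) = true) := by
  by_cases hQ : Q <;> simp [hQ, Xor]

/-- MASS OF A SECTION: for a fixed rest `r`, the column-sign section of the row event is a cylinder prescribing
the `w` distinct signs `A (a + i)`, `i < w`, so its `Ber(½)^{⊗ℤ}`-mass is `2^{-w}`. [folklore] -/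
theorem real_section_rowBlack (S : Set ℤ) (a b : ℤ) (w : ℕ)
    (r : Set ℤ × (Set (Site 2) × (Set (Site 2) × Set (Site 2)))) :
    (sitePercolation ℤ half).real ((fun A : Set ℤ => ((A, r) : Ω)) ⁻¹'
      {ω : Ω | ∀ i : Fin w, (![a + ((i : ℕ) : ℤ), b] : Site 2) ∈ blackSet S ω}) = (1 / 2) ^ w := by
  -- the prescribed signs
  set η : Fin w → Bool := fun i => !decide (Xor (b ∈ r.1)
    (Odd ((Finset.filter (fun f : ℤ × ℤ => (![f.1, f.2] : Site 2) ∈ parSet S (((∅ : Set ℤ), r) : Ω))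
      (Finset.Ico (min 0 (a + ((i : ℕ) : ℤ))) (max 0 (a + ((i : ℕ) : ℤ))) ×ˢ
        Finset.Ico (min 0 b) (max 0 b))).card)))
  have hset : (fun A : Set ℤ => ((A, r) : Ω)) ⁻¹'
      {ω : Ω | ∀ i : Fin w, (![a + ((i : ℕ) : ℤ), b] : Site 2) ∈ blackSet S ω} =
        {T : Set ℤ | ∀ i : Fin w, (a + ((i : ℕ) : ℤ) ∈ T ↔ η i = true)} := by
    ext T
    simp only [Set.mem_preimage, Set.mem_setOf_eq]
    exact forall_congr' fun i => (mem_blackSet_pair S T r _ b).trans (xor_iff_iff_bnot_decide _ _)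
  rw [hset, sitePercolation_real_cylinder half (e := fun i : Fin w => a + ((i : ℕ) : ℤ))
    (fun i j hij => Fin.ext (by simp only [add_right_inj, Nat.cast_inj] at hij; exact hij)) η,
    Finset.prod_congr rfl fun (i : Fin w) _ =>
      show (if η i then ((half : unitInterval) : ℝ) else 1 - half) = 1 / 2 by cases η i <;> norm_num [half],
    Finset.prod_const, Finset.card_univ, Fintype.card_fin]

/-- MASS OF THE ROW EVENT: `μIK {the w bottom cells black} = 2^{-w}` exactly, for every pattern `S` (Tonelli over
the rest of the gauge, `μIK = (column signs) ⊗ (rest)` by definition). [folklore] -/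
theorem real_rowBlack (S : Set ℤ) (a b : ℤ) (w : ℕ) :
    μIK.real {ω : Ω | ∀ i : Fin w, (![a + ((i : ℕ) : ℤ), b] : Site 2) ∈ blackSet S ω} = (1 / 2) ^ w := by
  have hsec : ∀ r, (sitePercolation ℤ half) ((fun A : Set ℤ => ((A, r) : Ω)) ⁻¹'
      {ω : Ω | ∀ i : Fin w, (![a + ((i : ℕ) : ℤ), b] : Site 2) ∈ blackSet S ω}) =
        ENNReal.ofReal ((1 / 2 : ℝ) ^ w) :=
    fun r => by rw [← real_section_rowBlack S a b w r, ofReal_measureReal]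
  rw [measureReal_def]
  unfold μIK
  rw [Measure.prod_apply_symm (measurableSet_rowBlack S a b w)]
  simp only [hsec, lintegral_const, measure_univ, mul_one]
  exact ENNReal.toReal_ofReal (by positivity)

end BottomRowFloor

/-- **STUB `stub_bottomRowFloor`** (registered signature): the explicit pattern-free crossing floor
`(1/2)^w ≤ P_S[LR(w × h at (a, b))]` for `1 ≤ w`, `1 ≤ h` — the all-black bottom row (mass exactly `2^{-w}`) is a
black LR crossing. [folklore] -/
theorem stub_bottomRowFloor :
    ∀ (S : Set ℤ) (a b : ℤ) (w h : ℕ), 1 ≤ w → 1 ≤ h → (1 / 2 : ℝ) ^ w ≤ pLR S a b w h := by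
  intro S a b w h hw hh
  haveI := isProbabilityMeasure_μIK
  unfold pLR
  rw [← BottomRowFloor.real_rowBlack S a b w]
  exact measureReal_mono (BottomRowFloor.rowBlack_subset_lrCross S a b hw hh)

/-- **`bottomRowFloor`** (export name used by the sibling stubs `stub_rswAssembly`, `stub_squaresFromTall`):
`(1/2)^w ≤ P_S[LR(w × h at (a, b))]` for `1 ≤ w`, `1 ≤ h`, every pattern `S`. [folklore] -/
theorem bottomRowFloor :
    ∀ (S : Set ℤ) (a b : ℤ) (w h : ℕ), 1 ≤ w → 1 ≤ h → (1 / 2 : ℝ) ^ w ≤ pLR S a b w h :=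
  stub_bottomRowFloor

end Summit.CriticalPhenomena.CardyFormulaZ2.Cruxes.IKMixedBoxCrossing.QuenchedChainFKG

end
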